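import Literature.MathematicalPhysics.QuantumFieldTheory.Balaban1983to89.B6LevelTower
import Literature.MathematicalPhysics.QuantumFieldTheory.Balaban1983to89.B6Lemma21Counterexample

/-!
# `Balaban1983to89.B6Lemma21TwoDimRefutation` — T. Bałaban, *Propagators and renormalization transformations for
lattice gauge theories. II*, Commun. Math. Phys. **96** (1984) 223–250 [Balaban1984PropagatorsII]: the printed
constant `c₁(α) = 12c₀(½α)^d` of Lemma 2.1 (2.61) p. 234 is exceeded in `d = 2` as well, on the planar two-level tower

statement-level skeleton of published theorems with citation tags; proofs where landed; nothing here is a claim about the Yang–Mills mass gap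

PDF held: `paper:balaban1984-cmp96-propagators-rt-ii` (journal page = PDF page + 222); the statements below were
read from the 300-dpi renders of pp. 224, 231–234 [PDF 2, 9–12]
(`pub-balaban/b2b-balaban-ref1/pages/1984-cmp96-propagators-rt-II/…-p002, p009, p010, p011, p012-x2.png`).

WHAT IS REPRODUCED / DECIDED.  SKELETON row `B6.Lem2.1` (lit-balaban, HOME `run/shared/lean/pub/lit-balaban/`,
PHASE2-TARGETS §G.3 line p04: *"decide sup_y Σ_{y′} e^{−αδ₀d(y,y′)} ≤ 12c₀(½α)² on the tower family
`B6LevelTower.twGeo` — prove or refute as printed"*), taken by the displaced proof seat p09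
(unit `lit-balaban-p09`).  The decl of record is `B6.Lemma21Printed` (p. 234 [PDF 12], verbatim: *"For the numbers
α, 0 < α < 1, c₁(α) = 12c₀^d(½α), and RM satisfying (2.59) we have … sup_{y∈𝔅} Σ_{y′∈𝔅} e^{−αδ₀d(y,y′)} ≤ c₁(α),
(2.61)"*), whose second conjunct is `B6RandomWalk.Ineq261`.  The sibling `…B6Lemma21Counterexample` refutes (2.61) for
`d ≥ 3` (d = 4 witness, the path bounds of a slab geometry taken as hypotheses); for `d = 2` the question was open
("numerically plausible").  THIS FILE DECIDES IT IN THE NEGATIVE, on a CONCRETE geometry of the tree with every path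
bound kernel-proved: on the planar (`d = 2`) two-level tower `B6LevelTower.twGeo 2 1 a m L η R` (levels Λ₀, Λ₁, one box
of `(a+1)²` points each, glued along the wall Σ₁, distance = the realised (2.46) `B6LevelTower.tdist`), for every
exponent `0 < αδ₀ ≤ 1/512` and every `L ≥ 8/(αδ₀)`, `a ≥ L²`, the row sum of (2.61) at the wall point `y₀ = (Λ₀; a, 0)`
exceeds `12c₀(½α)²` (`ineq261_fails`), although (2.2) (`B6LevelGapMetric.Cond22`), (2.59) (`B6.Cond259`) and
(2.60) (`B6RandomWalk.Ineq260`) all hold there (`cond22_holds`, `cond259_holds`, `ineq260_holds`); hence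
`B6.Lemma21Printed 2 δ₀ planarTowers` is FALSE for every `δ₀ > 0` (`not_lemma21Printed_planar`), and a numerical
instance is displayed (`decided_instance`: αδ₀ = 1/512, L = 4096, a = 2³⁶ = L³, R = a + 1, M = 1).

THE MECHANISM (located on the page; cf. GAPS G-A11-1 of the d = 4 sibling).  p. 233: *"From the condition (2.2) and
from the definition of the points y′_l, y_{l+1}, more exactly from the fact that they belong to different surfaces Σ_j,
we have (L^{j_{l,l+1}}η)^{−1}|y′_l − y_{l+1}| > RM. (2.57)"* is used in (2.58) for `l = 1, …, m` with `y_{m+1} = y′`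
(2.47), but `y′ ∈ Λ_{j′}` is not on a surface: the `m = 1` contours `y → Σ_{j+1} → (along Σ_{j+1}, on the COARSE side,
each Λ_{j+1}-bond costing 1 in (2.46) while covering L fine spacings) → back into Λ_j → y′` pay NO factor
`e^{−½αδ₀RM}`.  On the planar tower they give, for `y₀` on the wall and `y′ = (Λ₀; a − s, Lt + r)`,
`d(y₀, y′) ≤ 2 + t + s + r` (`dist_witness_le`), whence
`Σ_{y′} e^{−αδ₀ d(y₀,y′)} ≥ e^{−2αδ₀}·G(a+1)·G(L)·G(L)`, `G(m) = Σ_{j<m} e^{−αδ₀ j}` (`witness_le_rowSum`) — of order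
`(αδ₀)^{−3}` once `L ≳ 1/(αδ₀)`, against the printed `12c₀(½α)² ≤ 192.4(αδ₀)^{−2}` (`c1_two_upper`).  (Heuristic remark,
NOT proved here: for bounded L this family is only `O(L)(αδ₀)^{−2}`, so in d = 2 the failure needs a long fine/coarse
interface, L of order 10²; in d ≥ 3 the transverse directions supply the volume at any L — the sibling's d = 4 witness
has L = 32.)  Consumers in the tree use c₁ only as an α-dependent O(1) (`B6Lemma21Repaired`,
`DagBinding.B6Lemma21Param`); nothing else moves.

WHAT IS PROVED (kernel-checked; no `sorry`; axioms ⊆ {propext, Classical.choice, Quot.sound}).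
§1 admissible contours of the planar tower: the general wall bond `(Λ₀; a, Lt) ∼ (Λ₁; 0, t)` (`adj_wall_pt`), the
in-level staircase bound (`dist_pt_le`), the witness contour bound `dist_witness_le`.  §2 the witness family is
injective and its exponential sum factorises (private `witnessSum_eq`; `witness_le_rowSum`).  §3 elementary bounds,
valid for every rate `b > 0`: `G b m ≥ (1 − 1/(1 + bm))/b` (private `geomSum_lower`), `c₀(½α) ≤ 2/(x − x²)`,
`x = ½αδ₀ < 1` (`c0_half_upper`), `c₁ = 12c₀(½α)² ≤ 192(1024/1023)²/(αδ₀)²` for `αδ₀ ≤ 1/512` (`c1_two_upper`).  §4 the decision: `ineq261_fails`, `cond22_holds`, `cond259_holds`, `ineq260_holds`,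
`not_lemma21Printed_planar`, `decided_instance`.

ROW HISTORY / CREDITS (lit-balaban rulings G.5-22, G.5-26, G.5-32).  Row `B6.Lem2.1` was carved and nominated for
Phase 2 by the B6 reader seat r03 (ROWS-B6; the d = 2 question left "undecided" by `…B6Lemma21Counterexample`).  Three
kernel-checked witnesses now agree that the printed c₁ is exceeded in d = 2, all by the p. 233 mechanism above: the FILE
OF RECORD is the minted seat p04's `…B6Lemma21TwoDim` (p243253; regime αδ₀ ≤ 1/400, L = 1600); r03 g2's independent
build `…B6Lemma21TowerD2` (p243508; αδ₀ = 1/128, L = 1024, `not_lemma21Printed_tower`) and THIS file (seat p09,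
p243234; built independently under p09's 00:10Z claim, uniform regime 0 < αδ₀ ≤ 1/512, L ≥ 8/(αδ₀), a ≥ L²) are
companion witnesses.  v1.1 of this file = this paragraph only (no declaration changed).

HONEST SCOPE.  A located negative result about ONE printed constant on ONE family of realised multiscale geometries of
the tree (the "core sample" towers of `…B6LevelTower`, which model a nest of domains (2.1) along one axis; tangential
geometry, corners and the torus are not modelled — informally, a Λ_j-shell meeting Λ_{j+1} along a flat piece of Σ_{j+1}
of Λ_j-length ≥ L² contains the same contours, but no torus geometry is built here).  It does NOT touch Lemma 2.1 with
an α-dependent O(1) constant (`…B6Lemma21Repaired`/`…B6Lemma21Arith`), nor any consumer, and is NOT a statement about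
ultraviolet stability or any Clay problem.
-/

namespace Literature.MathematicalPhysics.QuantumFieldTheory.Balaban1983to89.B6Lemma21TwoDimRefutation

open Finset Real
open Literature.Probability.LatticeModels (latL1Dist)
open B6CoverTwoLevel (zv clampBox zv_clampBox)
open B6LevelTower
open B6Lemma21Counterexample (sum_exp_ge_of_paths c0_closed)
open B6RandomWalk (Ineq260 Ineq261)
open B6LevelGapMetric (Cond22)

noncomputable section

/-! ## §1  Admissible contours of the planar two-level tower `TW 2 1 a` -/

section Paths

variable {a : ℕ}

/-- The site of the planar two-level tower at level `j ∈ {0, 1}` with (clamped) integer Λ_j-coordinates `z = (z₀, z₁)`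
(𝔅 = Λ₀ ∪ Λ₁, (2.45)). [cite: Balaban1984PropagatorsII, (2.45) p.231] -/
def pt (j : Fin 2) (z : Fin 2 → ℤ) : TW 2 1 a := (j, clampBox a z)

/-- The box {0, …, a}² in integer coordinates. [folklore] -/
private theorem vec_mem_box {u v : ℤ} (hu0 : 0 ≤ u) (hua : u ≤ a) (hv0 : 0 ≤ v) (hva : v ≤ a) :
    (![u, v] : Fin 2 → ℤ) ∈ Set.Icc (0 : Fin 2 → ℤ) (fun _ => (a : ℤ)) := by
  constructor
  · intro μ
    fin_cases μ <;> simp [hu0, hv0]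
  · intro μ
    fin_cases μ <;> simp [hua, hva]

/-- Coordinates of a site built from a vector of the box. [folklore] -/
private theorem zv_pt {j : Fin 2} {z : Fin 2 → ℤ} (hz : z ∈ Set.Icc (0 : Fin 2 → ℤ) (fun _ => (a : ℤ))) :
    zv (pt j z : TW 2 1 a).2 = z := zv_clampBox hz

/-- The natural-number coordinate of such a site. [folklore] -/
private theorem coord_pt {j : Fin 2} {z : Fin 2 → ℤ} (hz : z ∈ Set.Icc (0 : Fin 2 → ℤ) (fun _ => (a : ℤ)))
    (μ : Fin 2) : (((pt j z : TW 2 1 a).2 μ : ℕ) : ℤ) = z μ := by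
  have h := congrFun (zv_pt (j := j) hz) μ
  simpa [zv] using h

/-- **The wall bonds of the planar tower**: the far-face point `(a, Lt)` of `Λ₀` and the near-face point `(0, t)` of
`Λ₁` are joined by an admissible bond (*"a part of Γ contained in B^j(Λ_j) consists of bonds of the lattice Λ_j"*; the
points of `Λ₁ ∩ Σ₁` sit on the sublattice `LΛ₀`). [cite: Balaban1984PropagatorsII, (2.46) p.231] -/
theorem adj_wall_pt (L : ℕ) {t v : ℤ} (ht0 : 0 ≤ t) (hta : t ≤ a) (hv : v = (L : ℤ) * t) (hva : v ≤ a) :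
    (graph L : SimpleGraph (TW 2 1 a)).Adj (pt 0 ![(a : ℤ), v]) (pt 1 ![0, t]) := by
  have hv0 : 0 ≤ v := by rw [hv]; positivity
  have hz : (![(a : ℤ), v] : Fin 2 → ℤ) ∈ Set.Icc (0 : Fin 2 → ℤ) (fun _ => (a : ℤ)) :=
    vec_mem_box (Nat.cast_nonneg a) le_rfl hv0 hva
  have hz' : (![(0 : ℤ), t] : Fin 2 → ℤ) ∈ Set.Icc (0 : Fin 2 → ℤ) (fun _ => (a : ℤ)) :=
    vec_mem_box le_rfl (Nat.cast_nonneg a) ht0 hta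
  rw [graph, SimpleGraph.fromRel_adj]
  refine ⟨fun heq => ?_, Or.inl (Or.inr ⟨rfl, ?_, ?_, ?_⟩)⟩
  · have h01 : (0 : Fin 2) = 1 := congrArg Prod.fst heq
    exact absurd h01 (by decide)
  · have h := coord_pt (j := 0) hz 0
    simp only [Matrix.cons_val_zero] at h
    exact_mod_cast h
  · have h := coord_pt (j := 1) hz' 0
    simp only [Matrix.cons_val_zero] at h
    exact_mod_cast h
  · intro μ hμ
    have hμ1 : μ = 1 := by
      fin_cases μ
      · exact absurd rfl hμ
      · rfl
    subst hμ1
    show zv (pt 0 ![(a : ℤ), v] : TW 2 1 a).2 1 = (L : ℤ) * zv (pt 1 ![(0 : ℤ), t] : TW 2 1 a).2 1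
    rw [zv_pt hz, zv_pt hz']
    simp [hv]

/-- **In-level staircases**: two sites of one level are at distance at most the ℓ¹ distance of their Λ_j-indices
(the in-box case of (2.66); contours through the other level may be shorter). [cite: Balaban1984PropagatorsII, (2.46) p.231] -/
theorem dist_pt_le (L : ℕ) (j : Fin 2) {z z' : Fin 2 → ℤ} (hz : z ∈ Set.Icc (0 : Fin 2 → ℤ) (fun _ => (a : ℤ)))
    (hz' : z' ∈ Set.Icc (0 : Fin 2 → ℤ) (fun _ => (a : ℤ))) :
    (graph L : SimpleGraph (TW 2 1 a)).dist (pt j z) (pt j z') ≤ (z 0 - z' 0).natAbs + (z 1 - z' 1).natAbs := by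
  change (graph L).dist (j, clampBox a z) (j, clampBox a z') ≤ _
  have h := dist_le_latL1Dist_of_lvl (d := 2) (k := 1) (a := a) L j (clampBox a z) (clampBox a z')
  rw [zv_clampBox hz, zv_clampBox hz'] at h
  simpa [latL1Dist, Fin.sum_univ_two] using h

/-- The base point of the witness: the wall point `y₀ = (a, 0)` of `Λ₀` (on the far face `x₀ = a`, on the sublattice
`LΛ₀` of the wall). [cite: Balaban1984PropagatorsII, (2.45)–(2.46) p.231] -/
def basePt (a : ℕ) : TW 2 1 a := pt 0 ![(a : ℤ), 0]

/-- The witness sites of `Λ₀`: `(a − s, Lt + r)`, indexed by `(s, t, r)`. [cite: Balaban1984PropagatorsII, (2.45) p.231] -/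
def witnessPt (a L : ℕ) (i : ℕ × ℕ × ℕ) : TW 2 1 a := pt 0 ![(a : ℤ) - i.1, ((L * i.2.1 + i.2.2 : ℕ) : ℤ)]

/-- The witness index set `{s ≤ a} × {t < N} × {r < L}`. [folklore] -/
def witnessIdx (a N L : ℕ) : Finset (ℕ × ℕ × ℕ) := range (a + 1) ×ˢ (range N ×ˢ range L)

/-- Arithmetic of the witness indices: for `t < N`, `r < L`, `L·N ≤ a`, `1 ≤ L` one has `Lt ≤ a`, `Lt + r ≤ a`,
`t ≤ a`. [folklore] -/
private theorem idx_bounds {L N t r : ℕ} (hL : 1 ≤ L) (hLN : L * N ≤ a) (ht : t < N) (hr : r < L) :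
    L * t + L ≤ a ∧ L * t + r ≤ a ∧ t ≤ a := by
  have h1 : L * t + L ≤ L * N := by
    have := Nat.mul_le_mul_left L (Nat.succ_le_of_lt ht)
    rwa [Nat.mul_succ] at this
  have h2 : t ≤ L * t := Nat.le_mul_of_pos_left t hL
  omega

/-- **The witness contours.**  From the wall point `y₀ = (Λ₀; a, 0)`: one wall bond up to `(Λ₁; 0, 0)`, `t` bonds of
`Λ₁` along the wall to `(Λ₁; 0, t)`, one wall bond down to `(Λ₀; a, Lt)`, then `s + r` bonds of `Λ₀` to
`y′ = (Λ₀; a − s, Lt + r)`: an admissible contour of `2 + t + s + r` bonds, each weighing 1 in (2.46) — the `m = 1`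
contours of (2.47) through the COARSE side of `Σ₁`, whose last leg carries no factor (2.57).
[cite: Balaban1984PropagatorsII, (2.46)–(2.47) p.231] -/
theorem dist_witness_le {L N : ℕ} (hL : 1 ≤ L) (hLN : L * N ≤ a) {i : ℕ × ℕ × ℕ} (hi : i ∈ witnessIdx a N L) :
    (graph L : SimpleGraph (TW 2 1 a)).dist (basePt a) (witnessPt a L i) ≤ 2 + i.1 + i.2.1 + i.2.2 := by
  obtain ⟨s, t, r⟩ := i
  simp only [witnessIdx, mem_product, mem_range] at hi
  obtain ⟨hs, ht, hr⟩ := hi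
  obtain ⟨hLt, hLtr, hta⟩ := idx_bounds hL hLN ht hr
  have hconn := graph_connected (d := 2) (k := 1) (a := a) L
  -- the four way-points
  let w₁ : TW 2 1 a := pt 1 ![(0 : ℤ), 0]
  let w₂ : TW 2 1 a := pt 1 ![(0 : ℤ), (t : ℤ)]
  let w₃ : TW 2 1 a := pt 0 ![(a : ℤ), ((L * t : ℕ) : ℤ)]
  -- y₀ ∼ w₁ (wall bond at t = 0)
  have h1 : (graph L).dist (basePt a) w₁ = 1 := by
    rw [SimpleGraph.dist_eq_one_iff_adj]
    exact adj_wall_pt L (t := 0) le_rfl (Nat.cast_nonneg a) (by simp) (Nat.cast_nonneg a)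
  -- w₁ → w₂ inside Λ₁
  have h2 : (graph L).dist w₁ w₂ ≤ t := by
    have h := dist_pt_le L 1 (z := ![(0 : ℤ), 0]) (z' := ![(0 : ℤ), (t : ℤ)])
      (vec_mem_box le_rfl (Nat.cast_nonneg a) le_rfl (Nat.cast_nonneg a))
      (vec_mem_box le_rfl (Nat.cast_nonneg a) (Nat.cast_nonneg t) (by exact_mod_cast hta))
    simpa using h
  -- w₂ ∼ w₃ (wall bond at t)
  have h3 : (graph L).dist w₂ w₃ = 1 := by
    rw [SimpleGraph.dist_comm, SimpleGraph.dist_eq_one_iff_adj]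
    refine adj_wall_pt L (t := (t : ℤ)) (Nat.cast_nonneg t) (by exact_mod_cast hta) (by push_cast; ring) ?_
    have : L * t ≤ a := by omega
    exact_mod_cast this
  -- w₃ → y′ inside Λ₀
  have h4 : (graph L).dist w₃ (witnessPt a L (s, t, r)) ≤ s + r := by
    have hz : (![(a : ℤ), ((L * t : ℕ) : ℤ)] : Fin 2 → ℤ) ∈ Set.Icc (0 : Fin 2 → ℤ) (fun _ => (a : ℤ)) :=
      vec_mem_box (Nat.cast_nonneg a) le_rfl (Nat.cast_nonneg _) (by exact_mod_cast (show L * t ≤ a by omega))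
    have hz' : (![(a : ℤ) - s, ((L * t + r : ℕ) : ℤ)] : Fin 2 → ℤ) ∈ Set.Icc (0 : Fin 2 → ℤ) (fun _ => (a : ℤ)) :=
      vec_mem_box (by omega) (by omega) (Nat.cast_nonneg _) (by exact_mod_cast hLtr)
    have h := dist_pt_le L 0 hz hz'
    have e1 : ((a : ℤ) - ((a : ℤ) - s)).natAbs = s := by omega
    have e2 : (((L * t : ℕ) : ℤ) - ((L * t + r : ℕ) : ℤ)).natAbs = r := by push_cast; omega
    simp only [Matrix.cons_val_zero, Matrix.cons_val_one] at h
    rw [e1, e2] at h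
    exact h
  calc (graph L).dist (basePt a) (witnessPt a L (s, t, r))
      ≤ (graph L).dist (basePt a) w₁ + (graph L).dist w₁ (witnessPt a L (s, t, r)) := hconn.dist_triangle
    _ ≤ (graph L).dist (basePt a) w₁ + ((graph L).dist w₁ w₂ + (graph L).dist w₂ (witnessPt a L (s, t, r))) := by
        gcongr; exact hconn.dist_triangle
    _ ≤ (graph L).dist (basePt a) w₁ + ((graph L).dist w₁ w₂ +
          ((graph L).dist w₂ w₃ + (graph L).dist w₃ (witnessPt a L (s, t, r)))) := by
        gcongr; exact hconn.dist_triangle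
    _ ≤ 1 + (t + (1 + (s + r))) := by rw [h1, h3]; gcongr
    _ = 2 + s + t + r := by ring

/-- The witness sites are distinct. [folklore] -/
private theorem witnessPt_injOn {L N : ℕ} (hL : 1 ≤ L) (hLN : L * N ≤ a) :
    Set.InjOn (witnessPt a L) ↑(witnessIdx a N L) := by
  intro i hi i' hi' h
  simp only [coe_product, coe_range, Set.mem_prod, Set.mem_Iio, witnessIdx] at hi hi'
  obtain ⟨hs, ht, hr⟩ := hi
  obtain ⟨hs', ht', hr'⟩ := hi'
  obtain ⟨-, hLtr, -⟩ := idx_bounds hL hLN ht hr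
  obtain ⟨-, hLtr', -⟩ := idx_bounds hL hLN ht' hr'
  have hz : (![(a : ℤ) - i.1, ((L * i.2.1 + i.2.2 : ℕ) : ℤ)] : Fin 2 → ℤ) ∈
      Set.Icc (0 : Fin 2 → ℤ) (fun _ => (a : ℤ)) :=
    vec_mem_box (by omega) (by omega) (Nat.cast_nonneg _) (by exact_mod_cast hLtr)
  have hz' : (![(a : ℤ) - i'.1, ((L * i'.2.1 + i'.2.2 : ℕ) : ℤ)] : Fin 2 → ℤ) ∈
      Set.Icc (0 : Fin 2 → ℤ) (fun _ => (a : ℤ)) :=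
    vec_mem_box (by omega) (by omega) (Nat.cast_nonneg _) (by exact_mod_cast hLtr')
  have hv := congrArg (fun p : TW 2 1 a => zv p.2) h
  simp only [witnessPt] at hv
  rw [zv_pt hz, zv_pt hz'] at hv
  have h0 : (a : ℤ) - i.1 = (a : ℤ) - i'.1 := by simpa using congrFun hv 0
  have h1 : ((L * i.2.1 + i.2.2 : ℕ) : ℤ) = ((L * i'.2.1 + i'.2.2 : ℕ) : ℤ) := by simpa using congrFun hv 1
  have h1' : L * i.2.1 + i.2.2 = L * i'.2.1 + i'.2.2 := by exact_mod_cast h1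
  have e1 : i.1 = i'.1 := by omega
  have hLpos : 0 < L := hL
  have e2 : i.2.1 = i'.2.1 := by
    have := congrArg (· / L) h1'
    simpa [Nat.mul_add_div hLpos, Nat.div_eq_of_lt hr, Nat.div_eq_of_lt hr'] using this
  have e3 : i.2.2 = i'.2.2 := by
    have := congrArg (· % L) h1'
    simpa [Nat.mul_add_mod, Nat.mod_eq_of_lt hr, Nat.mod_eq_of_lt hr'] using this
  exact Prod.ext e1 (Prod.ext e2 e3)

end Paths

/-! ## §2  The factorised witness sum and the lower bound for the (2.61) row sum -/

/-- The one-sided exponential sum `G_b(m) = Σ_{j<m} e^{−bj}` (a truncation of the printed `c₀`). [cite: Balaban1984PropagatorsII, p.233 (c₀(α))] -/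
def G (b : ℝ) (m : ℕ) : ℝ := ∑ j ∈ range m, Real.exp (-(b * j))

/-- `G` is nonnegative. [folklore] -/
private theorem G_nonneg (b : ℝ) (m : ℕ) : 0 ≤ G b m := sum_nonneg fun _ _ => (Real.exp_pos _).le

/-- **Factorisation of the witness sum**: `Σ_{(s,t,r)} e^{−b(2+s+t+r)} = e^{−2b}·G(a+1)·G(N)·G(L)`. [folklore] -/
private theorem witnessSum_eq (b : ℝ) (a N L : ℕ) :
    ∑ i ∈ witnessIdx a N L, Real.exp (-(b * ((2 + i.1 + i.2.1 + i.2.2 : ℕ) : ℝ)))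
      = Real.exp (-(b * 2)) * G b (a + 1) * G b N * G b L := by
  unfold witnessIdx G
  rw [mul_assoc, mul_assoc, Finset.sum_mul_sum, ← Finset.sum_product', Finset.sum_mul_sum, ← Finset.sum_product',
    Finset.mul_sum]
  refine Finset.sum_congr rfl fun i _ => ?_
  rw [← Real.exp_add, ← Real.exp_add, ← Real.exp_add]
  congr 1
  push_cast
  ring

/-- **The row sum of (2.61) at the wall point dominates the witness sum**: on the planar tower with `1 ≤ L`,
`L·N ≤ a`, for every rate `b ≥ 0`,
`e^{−2b}·G_b(a+1)·G_b(N)·G_b(L) ≤ Σ_{y′∈𝔅} e^{−b d(y₀,y′)}`. [cite: Balaban1984PropagatorsII, (2.61) p.234 + (2.46) p.231] -/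
theorem witness_le_rowSum {a L N : ℕ} (hL : 1 ≤ L) (hLN : L * N ≤ a) (m : ℕ) (η R : ℝ) {b : ℝ} (hb : 0 ≤ b) :
    Real.exp (-(b * 2)) * G b (a + 1) * G b N * G b L ≤
      ∑ y' : (twGeo 2 1 a m L η R).Site, Real.exp (-(b * (twGeo 2 1 a m L η R).dist (basePt a) y')) := by
  rw [← witnessSum_eq]
  refine sum_exp_ge_of_paths (twGeo 2 1 a m L η R).dist (basePt a) b hb (witnessIdx a N L) (witnessPt a L)
    (witnessPt_injOn hL hLN) _ fun i hi => ?_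
  show tdist L _ _ ≤ _
  unfold tdist
  exact_mod_cast dist_witness_le hL hLN hi

/-! ## §3  Elementary bounds (every rate `b > 0`) -/

/-- `e^{−x} ≤ 1/(1 + x)` for `x ≥ 0`. [folklore] -/
private theorem exp_neg_le_one_div {x : ℝ} (hx : 0 ≤ x) : Real.exp (-x) ≤ 1 / (1 + x) := by
  rw [Real.exp_neg, ← one_div]
  exact one_div_le_one_div_of_le (by linarith) (by linarith [Real.add_one_le_exp x])

/-- **Lower bound for the truncated geometric sums**: `G_b(m) ≥ (1 − 1/(1 + bm))/b` for `b > 0`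
(from `e^{−b} ≥ 1 − b` and `e^{−bm} ≤ 1/(1 + bm)`). [folklore] -/
private theorem geomSum_lower {b : ℝ} (hb : 0 < b) (m : ℕ) : (1 - 1 / (1 + b * m)) / b ≤ G b m := by
  set q : ℝ := Real.exp (-b) with hq
  have hq1 : q < 1 := by rw [hq, Real.exp_lt_one_iff]; linarith
  have hq0 : 0 < q := Real.exp_pos _
  have hbq : 1 - q ≤ b := by have := Real.add_one_le_exp (-b); rw [← hq] at this; linarith
  have hqm : q ^ m ≤ 1 / (1 + b * m) := by
    have : q ^ m = Real.exp (-(b * m)) := by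
      rw [hq, ← Real.exp_nat_mul]; congr 1; ring
    rw [this]
    exact exp_neg_le_one_div (by positivity)
  have hG : G b m = ∑ j ∈ range m, q ^ j := by
    unfold G
    refine Finset.sum_congr rfl fun j _ => ?_
    rw [hq, ← Real.exp_nat_mul]; congr 1; ring
  have hgeom : ∑ j ∈ range m, q ^ j = (1 - q ^ m) / (1 - q) := by
    rw [geom_sum_eq hq1.ne m]
    rw [show q ^ m - 1 = -(1 - q ^ m) by ring, show q - 1 = -(1 - q) by ring, neg_div_neg_eq]
  rw [hG, hgeom]
  have hnum : 0 ≤ 1 - q ^ m := by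
    have : q ^ m ≤ 1 := pow_le_one₀ hq0.le hq1.le
    linarith
  calc (1 - 1 / (1 + b * m)) / b ≤ (1 - q ^ m) / b := by
        apply div_le_div_of_nonneg_right _ hb.le
        linarith
    _ ≤ (1 - q ^ m) / (1 - q) := div_le_div_of_nonneg_left hnum (by linarith) hbq

/-- With `bm ≥ 8` the truncated sum is at least `(8/9)/b`. [folklore] -/
private theorem geomSum_lower' {b : ℝ} (hb : 0 < b) {m : ℕ} (hm : 8 ≤ b * m) : 8 / 9 / b ≤ G b m := by
  refine le_trans ?_ (geomSum_lower hb m)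
  apply div_le_div_of_nonneg_right _ hb.le
  have : 1 / (1 + b * m) ≤ 1 / 9 := one_div_le_one_div_of_le (by norm_num) (by linarith)
  linarith

/-- **Upper bound for the printed `c₀(½α)`**: `c₀(½α) = (1 + e^{−x})/(1 − e^{−x}) ≤ 2/(x − x²)` with `x = ½αδ₀`,
`0 < x < 1` (from `e^{−x} ≤ 1 − x + x²`). [cite: Balaban1984PropagatorsII, p.233 (c₀(α) = Σ_{z∈Z} e^{−αδ₀|z|})] -/
theorem c0_half_upper {δ₀ α : ℝ} (h0 : 0 < α * δ₀) (h1 : α * δ₀ < 2) :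
    B6.c0 δ₀ (α / 2) ≤ 2 / (α * δ₀ / 2 - (α * δ₀ / 2) ^ 2) := by
  set x : ℝ := α * δ₀ / 2 with hx
  have hx0 : 0 < x := by rw [hx]; linarith
  have hx1 : x < 1 := by rw [hx]; linarith
  have hpos : 0 < α / 2 * δ₀ := by linarith
  rw [c0_closed hpos, show α / 2 * δ₀ = x by rw [hx]; ring]
  set p : ℝ := Real.exp (-x) with hp
  have hp1 : p < 1 := by rw [hp, Real.exp_lt_one_iff]; linarith
  have hpx : p ≤ 1 - x + x ^ 2 := by
    have habs : |(-x)| ≤ 1 := by rw [abs_neg, abs_of_pos hx0]; exact hx1.le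
    have := Real.abs_exp_sub_one_sub_id_le habs
    rw [← hp] at this
    have := (abs_le.1 this).2
    nlinarith
  have hden : 0 < x - x ^ 2 := by nlinarith
  calc (1 + p) / (1 - p) ≤ 2 / (1 - p) := by
        apply div_le_div_of_nonneg_right _ (by linarith)
        linarith [pow_two_nonneg x]
    _ ≤ 2 / (x - x ^ 2) := div_le_div_of_nonneg_left (by norm_num) hden (by linarith)

/-- Hence, for `0 < αδ₀ ≤ 1/512`: `12c₀(½α)² ≤ 192·(1024/1023)²/(αδ₀)²`. [cite: Balaban1984PropagatorsII, Lemma 2.1 p.234 (c₁(α) = 12c₀^d(½α))] -/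
theorem c1_two_upper {δ₀ α : ℝ} (h0 : 0 < α * δ₀) (h1 : α * δ₀ ≤ 1 / 512) :
    B6.c1 2 δ₀ α ≤ 192 * (1024 / 1023) ^ 2 / (α * δ₀) ^ 2 := by
  set b : ℝ := α * δ₀ with hb
  have hc0 := c0_half_upper h0 (by linarith)
  rw [← hb] at hc0
  have hden : b / 2 * (1023 / 1024) ≤ b / 2 - (b / 2) ^ 2 := by nlinarith
  have hden0 : 0 < b / 2 * (1023 / 1024) := by positivity
  have hc0' : B6.c0 δ₀ (α / 2) ≤ 2 / (b / 2 * (1023 / 1024)) :=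
    hc0.trans (div_le_div_of_nonneg_left (by norm_num) hden0 hden)
  have hc0nn : 0 ≤ B6.c0 δ₀ (α / 2) := by
    have hpos : 0 < α / 2 * δ₀ := by linarith
    rw [c0_closed hpos]
    apply div_nonneg
    · positivity
    · have : Real.exp (-(α / 2 * δ₀)) < 1 := by rw [Real.exp_lt_one_iff]; linarith
      linarith
  unfold B6.c1
  have hsq := pow_le_pow_left₀ hc0nn hc0' 2
  calc 12 * B6.c0 δ₀ (α / 2) ^ 2 ≤ 12 * (2 / (b / 2 * (1023 / 1024))) ^ 2 := by gcongr
    _ = 192 * (1024 / 1023) ^ 2 / b ^ 2 := by field_simp; ring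

/-! ## §4  The decision: (2.61) fails in d = 2 on the planar tower, under (2.2), (2.59), (2.60) -/

/-- **Lower bound for the (2.61) row sum at the wall point**: for `0 < b = αδ₀ ≤ 1/512`, `L ≥ 8/b`, `L² ≤ a`,
`Σ_{y′} e^{−b d(y₀,y′)} ≥ (1 − 2b)(8/9)³/b³`. [cite: Balaban1984PropagatorsII, (2.61) p.234] -/
theorem rowSum_lower {a L : ℕ} {b : ℝ} (hb0 : 0 < b) (hb1 : b ≤ 1 / 512) (hL : 8 / b ≤ L) (ha : L * L ≤ a)
    (m : ℕ) (η R : ℝ) :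
    (1 - 2 * b) * (8 / 9) ^ 3 / b ^ 3 ≤
      ∑ y' : (twGeo 2 1 a m L η R).Site, Real.exp (-(b * (twGeo 2 1 a m L η R).dist (basePt a) y')) := by
  have hL8 : 8 ≤ b * L := by
    have := mul_le_mul_of_nonneg_left hL hb0.le
    rwa [mul_div_cancel₀ _ hb0.ne'] at this
  have hL1 : 1 ≤ L := Nat.one_le_iff_ne_zero.mpr (by rintro rfl; norm_num at hL8)
  have hLr : (1 : ℝ) ≤ L := by exact_mod_cast hL1
  have ha' : 8 ≤ b * ((a + 1 : ℕ) : ℝ) := by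
    have h1 : (L : ℝ) ≤ L * L := by nlinarith
    have h2 : ((L * L : ℕ) : ℝ) ≤ a := by exact_mod_cast ha
    push_cast at h2 ⊢
    nlinarith
  have hW := witness_le_rowSum hL1 ha m η R hb0.le (N := L)
  refine le_trans ?_ hW
  have g1 := geomSum_lower' hb0 ha'
  have g2 := geomSum_lower' hb0 hL8
  have e2 : 1 - 2 * b ≤ Real.exp (-(b * 2)) := by
    have := Real.add_one_le_exp (-(b * 2)); linarith
  have hpos : 0 < 8 / 9 / b := by positivity
  have h12 : 0 ≤ 1 - 2 * b := by linarith
  have hexp : 0 ≤ Real.exp (-(b * 2)) := (Real.exp_pos _).le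
  calc (1 - 2 * b) * (8 / 9) ^ 3 / b ^ 3 = (1 - 2 * b) * (8 / 9 / b) * (8 / 9 / b) * (8 / 9 / b) := by
        field_simp
    _ ≤ Real.exp (-(b * 2)) * G b (a + 1) * G b L * G b L :=
        mul_le_mul (mul_le_mul (mul_le_mul e2 g1 hpos.le hexp) g2 hpos.le (mul_nonneg hexp (G_nonneg _ _)))
          g2 hpos.le (mul_nonneg (mul_nonneg hexp (G_nonneg _ _)) (G_nonneg _ _))

/-- **(2.61) FAILS in d = 2 on the planar tower.**  For every exponent `0 < αδ₀ ≤ 1/512`, every `L ≥ 8/(αδ₀)` and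
`a ≥ L²` (any M, η, R): `¬ (sup_{y∈𝔅} Σ_{y′∈𝔅} e^{−αδ₀d(y,y′)} ≤ c₁(α) = 12c₀(½α)²)` — the row sum at the wall point
`y₀` already exceeds the printed constant. [cite: Balaban1984PropagatorsII, Lemma 2.1 (2.61) p.234] -/
theorem ineq261_fails {δ₀ α : ℝ} (h0 : 0 < α * δ₀) (h1 : α * δ₀ ≤ 1 / 512) {a L : ℕ} (hL : 8 / (α * δ₀) ≤ L)
    (ha : L * L ≤ a) (m : ℕ) (η R : ℝ) : ¬ Ineq261 2 (twGeo 2 1 a m L η R) δ₀ α := by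
  intro h261
  have hup := (h261 (basePt a)).trans (c1_two_upper h0 h1)
  have hlow := rowSum_lower h0 h1 hL ha m η R
  have hlt : 192 * (1024 / 1023 : ℝ) ^ 2 / (α * δ₀) ^ 2 < (1 - 2 * (α * δ₀)) * (8 / 9) ^ 3 / (α * δ₀) ^ 3 := by
    set b : ℝ := α * δ₀ with hb
    rw [div_lt_div_iff₀ (by positivity) (by positivity)]
    have key : 192 * (1024 / 1023 : ℝ) ^ 2 * b < (1 - 2 * b) * (8 / 9) ^ 3 := by nlinarith
    have hb2 : 0 < b ^ 2 := by positivity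
    calc 192 * (1024 / 1023 : ℝ) ^ 2 * b ^ 3 = (192 * (1024 / 1023) ^ 2 * b) * b ^ 2 := by ring
      _ < ((1 - 2 * b) * (8 / 9) ^ 3) * b ^ 2 := mul_lt_mul_of_pos_right key hb2
      _ = (1 - 2 * b) * (8 / 9) ^ 3 * b ^ 2 := by ring
  exact absurd (hlow.trans hup) (not_le.mpr hlt)

/-- **(2.2) HOLDS on these towers** (`…B6LevelGapMetric.Cond22`, the printed *"(L^jη)^{−1} dist(Ω_j^c, Ω_{j+1}) > RM"*
on lattice points) as soon as `RM ≤ a + 1`, `L ≥ 1`, `η > 0` — e.g. with `R = a + 1`, `M = 1`.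
[cite: Balaban1984PropagatorsII, (2.2) p.224] -/
theorem cond22_holds (a L : ℕ) (hL : 1 ≤ L) {η : ℝ} (hη : 0 < η) :
    Cond22 (twCS 2 1 a 1 L η ((a : ℝ) + 1)) (tposR L η) :=
  twCS_cond22_of_le 2 1 a 1 L η ((a : ℝ) + 1) hL hη (by push_cast; linarith)

/-- **(2.60) HOLDS on these towers** (R = a + 1, M = 1, any rate αδ₀ ≥ 0). [cite: Balaban1984PropagatorsII, (2.60) p.234] -/
theorem ineq260_holds (a L : ℕ) (hL : 1 ≤ L) (η : ℝ) {δ₀ α : ℝ} (hαδ : 0 ≤ α * δ₀) :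
    Ineq260 (twGeo 2 1 a 1 L η ((a : ℝ) + 1)) δ₀ α :=
  twGeo_ineq260 2 1 a 1 L η ((a : ℝ) + 1) hL (by push_cast; linarith) hαδ

/-- **(2.59) HOLDS on these towers**: with `R = a + 1`, `M = 1`, `a ≥ L³`, `L ≥ 8/(αδ₀)`, `0 < αδ₀ ≤ 1/512` the printed
condition *"¼αδ₀RM > 2d log c₀(½α) + 1 (2.59)"* (d = 2) is satisfied (`¼αδ₀(a+1) ≥ 128/(αδ₀)²`, while
`log c₀(½α) ≤ c₀(½α) − 1 < 4.01/(αδ₀)`). [cite: Balaban1984PropagatorsII, (2.59) p.233] -/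
theorem cond259_holds {δ₀ α : ℝ} (h0 : 0 < α * δ₀) (h1 : α * δ₀ ≤ 1 / 512) {a L : ℕ} (hL : 8 / (α * δ₀) ≤ L)
    (ha : L ^ 3 ≤ a) : B6.Cond259 2 δ₀ α ((a : ℝ) + 1) ((1 : ℕ) : ℝ) := by
  set b : ℝ := α * δ₀ with hb
  unfold B6.Cond259
  -- upper bound for the logarithm
  have hc0 := c0_half_upper h0 (by linarith)
  rw [← hb] at hc0
  have hden : b / 2 * (1023 / 1024) ≤ b / 2 - (b / 2) ^ 2 := by nlinarith
  have hden0 : 0 < b / 2 * (1023 / 1024) := by positivity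
  have hc0' : B6.c0 δ₀ (α / 2) ≤ 2 / (b / 2 * (1023 / 1024)) :=
    hc0.trans (div_le_div_of_nonneg_left (by norm_num) hden0 hden)
  have hc0pos : 0 < B6.c0 δ₀ (α / 2) := by
    have hpos : 0 < α / 2 * δ₀ := by linarith
    rw [c0_closed hpos]
    apply div_pos
    · positivity
    · have : Real.exp (-(α / 2 * δ₀)) < 1 := by rw [Real.exp_lt_one_iff]; linarith
      linarith
  have hlog : Real.log (B6.c0 δ₀ (α / 2)) ≤ 2 / (b / 2 * (1023 / 1024)) - 1 :=
    (Real.log_le_sub_one_of_pos hc0pos).trans (by linarith)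
  have hlog' : Real.log (B6.c0 δ₀ (α / 2)) ≤ 4096 / 1023 / b - 1 := by
    rw [show 2 / (b / 2 * (1023 / 1024 : ℝ)) = 4096 / 1023 / b by field_simp; ring] at hlog
    exact hlog
  -- lower bound for the right-hand side
  have hL0 : (0 : ℝ) ≤ L := Nat.cast_nonneg L
  have h8b : 0 < 8 / b := by positivity
  have hL3 : (8 / b) ^ 3 ≤ ((a : ℝ) + 1) := by
    have h1' : (8 / b) ^ 3 ≤ (L : ℝ) ^ 3 := pow_le_pow_left₀ h8b.le hL 3
    have h2' : ((L ^ 3 : ℕ) : ℝ) ≤ a := by exact_mod_cast ha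
    push_cast at h2'
    linarith
  have hrhs : 128 / b ^ 2 ≤ 1 / 4 * α * δ₀ * ((a : ℝ) + 1) * ((1 : ℕ) : ℝ) := by
    rw [show 1 / 4 * α * δ₀ * ((a : ℝ) + 1) * ((1 : ℕ) : ℝ) = b / 4 * ((a : ℝ) + 1) by rw [hb]; push_cast; ring]
    have : b / 4 * (8 / b) ^ 3 = 128 / b ^ 2 := by field_simp; ring
    rw [← this]
    exact mul_le_mul_of_nonneg_left hL3 (by positivity)
  -- comparison: 2·2·(4096/1023/b − 1) + 1 < 128/b²
  have hcmp : 2 * (2 : ℕ) * (4096 / 1023 / b - 1) + 1 < 128 / b ^ 2 := by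
    push_cast
    rw [show (2 : ℝ) * 2 * (4096 / 1023 / b - 1) + 1 = (16384 / 1023 - 3 * b) / b by field_simp; ring]
    rw [div_lt_div_iff₀ h0 (by positivity)]
    nlinarith
  have h2d : (0 : ℝ) ≤ 2 * (2 : ℕ) := by norm_num
  calc 2 * (2 : ℕ) * Real.log (B6.c0 δ₀ (α / 2)) + 1 ≤ 2 * (2 : ℕ) * (4096 / 1023 / b - 1) + 1 := by
        gcongr
    _ < 128 / b ^ 2 := hcmp
    _ ≤ _ := hrhs

/-- `L·L ≤ L³` in ℕ. [folklore] -/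
private theorem sq_le_cube (L : ℕ) : L * L ≤ L ^ 3 := by
  rcases Nat.eq_zero_or_pos L with h | h
  · simp [h]
  · calc L * L = L ^ 2 * 1 := by ring
      _ ≤ L ^ 2 * L := Nat.mul_le_mul_left _ h
      _ = L ^ 3 := by ring

/-- The planar tower family of the tree, indexed by `(a, M, L, η, R)`: the geometries
`B6LevelTower.twGeo 2 1 a M L η R` (two levels Λ₀, Λ₁ in d = 2). [cite: Balaban1984PropagatorsII, (2.1)–(2.4) p.224 + (2.45)–(2.46) p.231] -/
def planarTowers : ℕ × ℕ × ℕ × ℝ × ℝ → B6.Geometry :=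
  fun p => twGeo 2 1 p.1 p.2.1 p.2.2.1 p.2.2.2.1 p.2.2.2.2

/-- **Lemma 2.1 AS PRINTED is false in d = 2 on the planar tower family, for every δ₀ > 0.**  Given δ₀, take
`α = 1/(512(δ₀ + 1)) ∈ (0, 1)` (so `0 < αδ₀ < 1/512`), `L = ⌈8/(αδ₀)⌉`, `a = L³`, `R = a + 1`, `M = 1`: the
hypotheses of `B6.Lemma21Printed` (`Hyp21_22`, `0 < α < 1`, (2.59)) hold — and (2.2), (2.60) hold as well
(`cond22_holds`, `ineq260_holds`) — but (2.61) fails (`ineq261_fails`). [cite: Balaban1984PropagatorsII, Lemma 2.1 (2.60)–(2.61) p.234] -/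
theorem not_lemma21Printed_planar {δ₀ : ℝ} (hδ₀ : 0 < δ₀) : ¬ B6.Lemma21Printed 2 δ₀ planarTowers := by
  intro h
  set α : ℝ := 1 / (512 * (δ₀ + 1)) with hα
  have hα0 : 0 < α := by rw [hα]; positivity
  have hα1 : α < 1 := by
    rw [hα, div_lt_one (by positivity)]; nlinarith
  have hb0 : 0 < α * δ₀ := mul_pos hα0 hδ₀
  have hb1 : α * δ₀ ≤ 1 / 512 := by
    rw [hα, div_mul_eq_mul_div, one_mul, div_le_div_iff₀ (by positivity) (by norm_num)]
    nlinarith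
  set L : ℕ := ⌈8 / (α * δ₀)⌉₊ with hL
  have hL8 : 8 / (α * δ₀) ≤ L := Nat.le_ceil _
  have h1 := h (L ^ 3, 1, L, 1, ((L ^ 3 : ℕ) : ℝ) + 1) trivial α hα0 hα1
    (cond259_holds hb0 hb1 hL8 le_rfl)
  exact ineq261_fails hb0 hb1 hL8 (sq_le_cube L) 1 1 _ h1.2

/-- **A numerical instance** (non-vacuity, all side conditions together): `αδ₀ = 1/512` (δ₀ = 1, α = 1/512),
`L = 4096`, `a = 2³⁶ = L³`, `M = 1`, `R = a + 1`, `η = 1`: (2.2), (2.59) and (2.60) HOLD on this planar tower and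
(2.61) FAILS. [cite: Balaban1984PropagatorsII, Lemma 2.1 p.234 + (2.2) p.224 + (2.59) p.233] -/
theorem decided_instance :
    Cond22 (twCS 2 1 (2 ^ 36) 1 4096 1 (((2 ^ 36 : ℕ) : ℝ) + 1)) (tposR 4096 1) ∧
    B6.Cond259 2 1 (1 / 512) (((2 ^ 36 : ℕ) : ℝ) + 1) ((1 : ℕ) : ℝ) ∧
    Ineq260 (twGeo 2 1 (2 ^ 36) 1 4096 1 (((2 ^ 36 : ℕ) : ℝ) + 1)) 1 (1 / 512) ∧
    ¬ Ineq261 2 (twGeo 2 1 (2 ^ 36) 1 4096 1 (((2 ^ 36 : ℕ) : ℝ) + 1)) 1 (1 / 512) := by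
  have hb : (1 / 512 : ℝ) * 1 = 1 / 512 := by norm_num
  have h0 : (0 : ℝ) < 1 / 512 * 1 := by norm_num
  have h1 : (1 / 512 : ℝ) * 1 ≤ 1 / 512 := by norm_num
  have hL : 8 / ((1 / 512 : ℝ) * 1) ≤ ((4096 : ℕ) : ℝ) := by norm_num
  refine ⟨?_, ?_, ?_, ?_⟩
  · exact cond22_holds (2 ^ 36) 4096 (by norm_num) one_pos
  · exact cond259_holds h0 h1 hL (by norm_num)
  · exact ineq260_holds (2 ^ 36) 4096 (by norm_num) 1 h0.le
  · exact ineq261_fails h0 h1 hL (by norm_num) 1 1 _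

end

end Literature.MathematicalPhysics.QuantumFieldTheory.Balaban1983to89.B6Lemma21TwoDimRefutation
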